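import Literature.Probability.Percolation.DualFaceChains
import Literature.Probability.Percolation.AnnulusCrossingBound
import Literature.Probability.Percolation.BoxCrossingProofs
import HarnessLib

/-!
# Two lattice tools: the lattice shadow of a planar path, and confinement of clusters by an annulus

Topic `Literature/Probability/Percolation`; proofs only.

* `exists_walk_shadowing_path` — **a continuous path is shadowed by a lattice walk**: for
  `δ > 0` and a continuous `γ : [0, 1] → ℂ` there is a walk of `ℤ²` from a site whose mesh square
  `[δu, δu + δ]²` contains `γ 0` to one whose square contains `γ 1`, every site of which has its
  mesh square met by the path (hence is within `2δ` of the path, `dist_meshPoint_le_of_mem_face`).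
  This is the face-chain construction of `DualFaceChains.exists_dualConfig_openConnIn_of_path`
  (Schramm–Smirnov 2011, proof of Lemma 6.1) read for the empty configuration, all of whose dual
  edges are open.
* `norm_meshPoint_lt_of_mem_openCluster_of_not_mem_annulusOpenCrossing`,
  `finite_openCluster_of_not_mem_annulusOpenCrossing` — **no open crossing of the annulus
  `A(0; W₀, W₁)` confines the open clusters of the sites of `B̄(0, W₀)` to `B(0, W₁)`**, in
  particular they are finite (Bollobás–Riordan 2006, Ch. 7, before Lemma 4: stop an escaping open
  path at its first exit).

## References

* O. Schramm, S. Smirnov, Ann. Probab. 39 (2011), proof of Lemma 6.1 [SchrammSmirnov2011].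
* B. Bollobás, O. Riordan, *Percolation* (2006), Ch. 7 [BollobasRiordan2006].
-/

noncomputable section

namespace Literature.Probability.Percolation

open Set Metric LatticeModels Complex

/-! ### The lattice shadow of a path -/

/-- The empty configuration has no drawn open edges. [folklore] -/
theorem openEdgeUnion_empty (δ : ℝ) : openEdgeUnion δ (∅ : BondConfig (Site 2)) = ∅ := by
  simp [openEdgeUnion]

/-- **A continuous path is shadowed by a lattice walk.** For `δ > 0` and `γ` continuous on
`[0, 1]` there are sites `u`, `w` with `γ 0 ∈ [δu, δu+δ]²`, `γ 1 ∈ [δw, δw+δ]²` and a walk of `ℤ²`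
from `u` to `w` every site `x` of which satisfies `γ t ∈ [δx, δx+δ]²` for some `t ∈ [0, 1]`.
[cite: SchrammSmirnov2011, proof of Lemma 6.1] -/
theorem exists_walk_shadowing_path {δ : ℝ} (hδ : 0 < δ) {γ : ℝ → ℂ} (hγ : ContinuousOn γ (Icc 0 1)) :
    ∃ (u w : Site 2) (π : (zdGraph 2).Walk u w),
      γ 0 ∈ Icc (δ * (u 0 : ℝ)) (δ * (u 0 : ℝ) + δ) ×ℂ Icc (δ * (u 1 : ℝ)) (δ * (u 1 : ℝ) + δ) ∧
      γ 1 ∈ Icc (δ * (w 0 : ℝ)) (δ * (w 0 : ℝ) + δ) ×ℂ Icc (δ * (w 1 : ℝ)) (δ * (w 1 : ℝ) + δ) ∧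
      ∀ x ∈ π.support, ∃ t ∈ Icc (0 : ℝ) 1,
        γ t ∈ Icc (δ * (x 0 : ℝ)) (δ * (x 0 : ℝ) + δ) ×ℂ Icc (δ * (x 1 : ℝ)) (δ * (x 1 : ℝ) + δ) := by
  set S : Set (Site 2) := {x | ∃ t ∈ Icc (0 : ℝ) 1,
    γ t ∈ Icc (δ * (x 0 : ℝ)) (δ * (x 0 : ℝ) + δ) ×ℂ Icc (δ * (x 1 : ℝ)) (δ * (x 1 : ℝ) + δ)} with hS
  obtain ⟨u, w, hu, hw, hconn⟩ := exists_dualConfig_openConnIn_of_path hδ (ω := (∅ : BondConfig (Site 2))) hγ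
    (fun t _ h ↦ by rw [openEdgeUnion_empty] at h; exact h) (S := S) fun x t ht h ↦ ⟨t, ht, h⟩
  obtain ⟨π, hπS, -⟩ := exists_walk_of_mem_openConnIn
    (fun _ h ↦ h.1 : dualConfig (∅ : BondConfig (Site 2)) ⊆ (zdGraph 2).edgeSet) hconn
  exact ⟨u, w, π, hu, hw, fun x hx ↦ hπS x hx⟩

/-- **Sites of the shadowing walk are within `2δ` of the path.** [cite: SchrammSmirnov2011, proof of Lemma 6.1] -/
theorem exists_walk_near_path {δ : ℝ} (hδ : 0 < δ) {γ : ℝ → ℂ} (hγ : ContinuousOn γ (Icc 0 1)) :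
    ∃ (u w : Site 2) (π : (zdGraph 2).Walk u w),
      dist (meshPoint δ u) (γ 0) ≤ 2 * δ ∧ dist (meshPoint δ w) (γ 1) ≤ 2 * δ ∧
      γ 1 ∈ Icc (δ * (w 0 : ℝ)) (δ * (w 0 : ℝ) + δ) ×ℂ Icc (δ * (w 1 : ℝ)) (δ * (w 1 : ℝ) + δ) ∧
      γ 0 ∈ Icc (δ * (u 0 : ℝ)) (δ * (u 0 : ℝ) + δ) ×ℂ Icc (δ * (u 1 : ℝ)) (δ * (u 1 : ℝ) + δ) ∧
      ∀ x ∈ π.support, ∃ t ∈ Icc (0 : ℝ) 1, dist (meshPoint δ x) (γ t) ≤ 2 * δ := by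
  obtain ⟨u, w, π, hu, hw, hπ⟩ := exists_walk_shadowing_path hδ hγ
  refine ⟨u, w, π, dist_meshPoint_le_of_mem_face hδ hu, dist_meshPoint_le_of_mem_face hδ hw, hw, hu,
    fun x hx ↦ ?_⟩
  obtain ⟨t, ht, h⟩ := hπ x hx
  exact ⟨t, ht, dist_meshPoint_le_of_mem_face hδ h⟩

/-- **The mesh square containing the centre of the square of `g` is the square of `g`.**
[folklore] -/
theorem eq_of_center_mem_face {δ : ℝ} (hδ : 0 < δ) {g w : Site 2}
    (h : ((δ : ℂ) * (((g 0 : ℝ) : ℂ) + 1 / 2) + (δ : ℂ) * (((g 1 : ℝ) : ℂ) + 1 / 2) * Complex.I) ∈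
      Icc (δ * (w 0 : ℝ)) (δ * (w 0 : ℝ) + δ) ×ℂ Icc (δ * (w 1 : ℝ)) (δ * (w 1 : ℝ) + δ)) :
    w = g := by
  rw [mem_reProdIm, mem_Icc, mem_Icc] at h
  have hre : ((δ : ℂ) * (((g 0 : ℝ) : ℂ) + 1 / 2) + (δ : ℂ) * (((g 1 : ℝ) : ℂ) + 1 / 2) * Complex.I).re =
      δ * ((g 0 : ℝ) + 1 / 2) := by simp
  have him : ((δ : ℂ) * (((g 0 : ℝ) : ℂ) + 1 / 2) + (δ : ℂ) * (((g 1 : ℝ) : ℂ) + 1 / 2) * Complex.I).im =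
      δ * ((g 1 : ℝ) + 1 / 2) := by simp
  rw [hre, him] at h
  obtain ⟨⟨h1, h2⟩, ⟨h3, h4⟩⟩ := h
  have e0 : (w 0 : ℝ) ≤ g 0 + 1 / 2 ∧ (g 0 : ℝ) + 1 / 2 ≤ w 0 + 1 := by
    constructor <;> nlinarith
  have e1 : (w 1 : ℝ) ≤ g 1 + 1 / 2 ∧ (g 1 : ℝ) + 1 / 2 ≤ w 1 + 1 := by
    constructor <;> nlinarith
  have f0 : w 0 = g 0 := by
    have a : (w 0 : ℝ) < g 0 + 1 := by linarith
    have b : (g 0 : ℝ) < w 0 + 1 := by linarith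
    have a' : w 0 < g 0 + 1 := by exact_mod_cast a
    have b' : g 0 < w 0 + 1 := by exact_mod_cast b
    omega
  have f1 : w 1 = g 1 := by
    have a : (w 1 : ℝ) < g 1 + 1 := by linarith
    have b : (g 1 : ℝ) < w 1 + 1 := by linarith
    have a' : w 1 < g 1 + 1 := by exact_mod_cast a
    have b' : g 1 < w 1 + 1 := by exact_mod_cast b
    omega
  exact Site.eq_iff_two.2 ⟨f0, f1⟩

/-- **A lattice point in the mesh square of `u` is one of its four corners.** [folklore] -/
theorem exists_eq_add_of_meshPoint_mem_face {δ : ℝ} (hδ : 0 < δ) {x u : Site 2}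
    (h : meshPoint δ x ∈ Icc (δ * (u 0 : ℝ)) (δ * (u 0 : ℝ) + δ) ×ℂ Icc (δ * (u 1 : ℝ)) (δ * (u 1 : ℝ) + δ)) :
    ∃ a b : ℤ, (a = 0 ∨ a = 1) ∧ (b = 0 ∨ b = 1) ∧ x 0 = u 0 + a ∧ x 1 = u 1 + b := by
  rw [mem_reProdIm, mem_Icc, mem_Icc] at h
  simp only [meshPoint, Complex.mul_re, Complex.ofReal_re, Complex.ofReal_im, zero_mul, sub_zero,
    Complex.mul_im, add_zero, Site.toComplex_re, Site.toComplex_im] at h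
  obtain ⟨⟨h1, h2⟩, ⟨h3, h4⟩⟩ := h
  have e0 : (u 0 : ℝ) ≤ x 0 ∧ (x 0 : ℝ) ≤ u 0 + 1 := by constructor <;> nlinarith
  have e1 : (u 1 : ℝ) ≤ x 1 ∧ (x 1 : ℝ) ≤ u 1 + 1 := by constructor <;> nlinarith
  have e0' : u 0 ≤ x 0 ∧ x 0 ≤ u 0 + 1 := ⟨by exact_mod_cast e0.1, by exact_mod_cast e0.2⟩
  have e1' : u 1 ≤ x 1 ∧ x 1 ≤ u 1 + 1 := ⟨by exact_mod_cast e1.1, by exact_mod_cast e1.2⟩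
  refine ⟨x 0 - u 0, x 1 - u 1, by omega, by omega, by omega, by omega⟩

/-! ### Confinement of clusters by an uncrossed annulus -/

/-- **No open crossing of `A(0; W₀, W₁)` confines the clusters of `B̄(0, W₀)` to `B(0, W₁)`**:
if `ω ∉ annulusOpenCrossing 0 δ W₀ W₁` (`0 < δ`) and `‖δx‖ ≤ W₀`, then every site `y` of the
open cluster of `x` has `‖δy‖ < W₁` (stop an escaping open path at its first site at distance
`≥ W₁`; up to there it runs through sites within `W₁ + 2δ`). [cite: BollobasRiordan2006, Ch. 7 Lemma 4] -/
theorem norm_meshPoint_lt_of_mem_openCluster_of_not_mem_annulusOpenCrossing {ω : BondConfig (Site 2)}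
    (hωE : ω ⊆ (zdGraph 2).edgeSet) {δ W₀ W₁ : ℝ} (hδ : 0 < δ) (hW : W₀ < W₁)
    (hω : ω ∉ annulusOpenCrossing 0 δ W₀ W₁) {x y : Site 2} (hx : ‖meshPoint δ x‖ ≤ W₀)
    (hy : y ∈ openCluster ω x) : ‖meshPoint δ y‖ < W₁ := by
  classical
  by_contra hge
  rw [not_lt] at hge
  -- an open walk from `x` to `y`
  obtain ⟨p⟩ := (show (openGraph ω).Reachable x y from hy)
  have hpE : ∀ e ∈ p.edges, e ∈ (zdGraph 2).edgeSet := fun e he ↦ by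
    have := p.edges_subset_edgeSet he
    rw [openGraph, SimpleGraph.edgeSet_fromEdgeSet] at this
    exact hωE this.1
  set p' : (zdGraph 2).Walk x y := p.transfer (zdGraph 2) hpE with hp'
  have hp'ω : ∀ e ∈ p'.edges, e ∈ ω := fun e he ↦ by
    rw [hp', SimpleGraph.Walk.edges_transfer] at he
    have := p.edges_subset_edgeSet he
    rw [openGraph, SimpleGraph.edgeSet_fromEdgeSet] at this
    exact this.1
  -- stop at the first site at distance `≥ W₁`
  obtain ⟨z, q, hz, -, hqE, hq, hlast⟩ :=
    exists_walk_until (G := zdGraph 2) (fun v : Site 2 ↦ W₁ ≤ ‖meshPoint δ v‖) p' hge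
  have hqω : ∀ e ∈ q.edges, e ∈ ω := fun e he ↦ hp'ω e (hqE e he)
  -- the stopped walk stays within `W₁ + 2δ`
  have hzle : ‖meshPoint δ z‖ ≤ W₁ + 2 * δ := by
    rcases hlast with rfl | ⟨v, hvz, hv⟩
    · linarith
    · rw [not_le] at hv
      have hd : dist (meshPoint δ v) (meshPoint δ z) = δ := by
        rw [dist_meshPoint_of_adj hvz, abs_of_pos hδ]
      have := norm_le_norm_add_norm_sub' (meshPoint δ z) (meshPoint δ v)  -- ‖z‖ ≤ ‖v‖ + ‖z - v‖
      rw [← dist_eq_norm, dist_comm, hd] at this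
      linarith
  have hS : ∀ v ∈ q.support, v ∈ {v : Site 2 | dist (meshPoint δ v) 0 ≤ W₁ + 2 * δ} := by
    intro v hv
    rw [mem_setOf_eq, dist_zero_right]
    rcases hq v hv with h | rfl
    · rw [not_le] at h; linarith
    · exact hzle
  refine hω (mem_annulusOpenCrossing_iff.2 ⟨x, by rwa [dist_zero_right], z, by rwa [dist_zero_right],
    mem_openConnIn_of_walk q hS hqω⟩)

/-- Sites of `ℤ²` whose mesh points lie in a bounded ball form a finite set. [folklore] -/
theorem finite_setOf_norm_meshPoint_lt {δ : ℝ} (hδ : 0 < δ) (W : ℝ) :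
    {y : Site 2 | ‖meshPoint δ y‖ < W}.Finite := by
  have hsub : {y : Site 2 | ‖meshPoint δ y‖ < W} ⊆
      (fun p : ℤ × ℤ ↦ (![p.1, p.2] : Site 2)) '' (Finset.Icc (-⌈W / δ⌉) ⌈W / δ⌉ ×ˢ Finset.Icc (-⌈W / δ⌉) ⌈W / δ⌉ : Finset (ℤ × ℤ)) := by
    intro y hy
    rw [mem_setOf_eq] at hy
    have hc : ∀ i : Fin 2, |(y i : ℝ)| < W / δ := by
      intro i
      have h1 : |(meshPoint δ y).re| ≤ ‖meshPoint δ y‖ := Complex.abs_re_le_norm _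
      have h2 : |(meshPoint δ y).im| ≤ ‖meshPoint δ y‖ := Complex.abs_im_le_norm _
      simp only [meshPoint, Complex.mul_re, Complex.ofReal_re, Complex.ofReal_im, zero_mul, sub_zero,
        Complex.mul_im, add_zero, Site.toComplex_re, Site.toComplex_im, abs_mul, abs_of_pos hδ] at h1 h2
      rw [lt_div_iff₀ hδ]
      fin_cases i
      · simpa [mul_comm] using h1.trans_lt hy
      · simpa [mul_comm] using h2.trans_lt hy
    have hb : ∀ i : Fin 2, -⌈W / δ⌉ ≤ y i ∧ y i ≤ ⌈W / δ⌉ := by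
      intro i
      have := abs_lt.1 (hc i)
      have hceil := Int.le_ceil (W / δ)
      constructor
      · have : (-(⌈W / δ⌉ : ℝ)) < y i := by linarith
        exact_mod_cast this.le
      · have : (y i : ℝ) < ⌈W / δ⌉ := by linarith
        exact_mod_cast this.le
    refine ⟨(y 0, y 1), ?_, ?_⟩
    · simp only [Finset.coe_product, Finset.coe_Icc, mem_prod, mem_Icc]
      exact ⟨hb 0, hb 1⟩
    · exact (Site.eq_iff_two.2 ⟨by simp, by simp⟩)
  exact (Set.Finite.image _ (Finset.finite_toSet _)).subset hsub

/-- **No open crossing of `A(0; W₀, W₁)` makes the clusters of `B̄(0, W₀)` finite.**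
[cite: BollobasRiordan2006, Ch. 7 Lemma 4] -/
theorem finite_openCluster_of_not_mem_annulusOpenCrossing {ω : BondConfig (Site 2)}
    (hωE : ω ⊆ (zdGraph 2).edgeSet) {δ W₀ W₁ : ℝ} (hδ : 0 < δ) (hW : W₀ < W₁)
    (hω : ω ∉ annulusOpenCrossing 0 δ W₀ W₁) {x : Site 2} (hx : ‖meshPoint δ x‖ ≤ W₀) :
    (openCluster ω x).Finite :=
  (finite_setOf_norm_meshPoint_lt hδ W₁).subset fun _ hy ↦
    norm_meshPoint_lt_of_mem_openCluster_of_not_mem_annulusOpenCrossing hωE hδ hW hω hx hy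

end Literature.Probability.Percolation

end
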